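import Literature.MathematicalPhysics.QuantumFieldTheory.Balaban1983to89.Node00.TorusCoverCubeRecordDentCells
import Literature.MathematicalPhysics.QuantumFieldTheory.Balaban1983to89.Node00.TorusCoverLandau153RecCubeDomains
import Literature.MathematicalPhysics.QuantumFieldTheory.Balaban1983to89.Node00.TorusCoverLevels

/-!
# NODE 00 — THE R7 DOOR's STAGE 3b AT THE DENTED RECORD DATUM: [Balaban1985Variational] (153) for the MEET `D″ = cubeDomains ⊓ D₂` from the Landau form `IsLandau138Z` on the
# cells of `recordCubePZ … (D₂.Om j)` — the CONVERSE cell dictionary (crown cells of the dented datum ARE cells of `D″`) and the `recordCubePZ` twin of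
# ✓`TorusCoverLandau153RecCubeDomains.RE_dsE_re_im_eq_zero_meet_of_isLandau138Z_propCubePZ`

Cell `pub-ymgap`, seat `pub-ymgap-dag-n07-e` g32 (FAN-OUT §N07 row s3; LANE OWNER of the K0 road chart side; (W2) «rows 1–8 at the dented datum» handed over by the junction seat dag-n07-w3
g13, pub-ymgap bus 2026-08-30 02:20Z, split (P-b)(i)).  `--kind proof --supports stmt-QuantumFields-20541` (K0⁷; count-neutral; THEOREMS ONLY).  [15] = [Balaban1985Variational];
[6] = [Balaban1985RegularSpaces]; [II] = [Balaban1984PropagatorsII]; [I] = [Balaban1987RG1].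

WHY.  Row 8 of the def of record `HThm4RecSym152PhiEG` ((153): `RE (domainsMeet (cubeDomains …) (domainsOfSeq s.Ω j hk)) η⁻¹ (dsE η⁻¹ (Re∕Im(φ∘A))) = 0`) was derived for the
EMPTY-dent datum `propCubePZ` by ✓`…RecCubeDomains` from the crown's Landau form on `propCubePZ`'s cells, via the CUBE family's kernel rows and a kernel inclusion.  At the DENTED datum
`recordCubePZ … (D₂.Om j)` (✓p749305; [15] (150) «Ω′_k = □_k ∩ Ω_k») the Landau form holds on the DENTED cells — fewer at the top, MORE on the dent layer — so the cube family's kernel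
is the wrong currency; the right one is the meet's own kernel `N(Q′_{D″})`: a test function of `D″` has vanishing block sums at `D″`'s cells ([II] (2.7)), and every crown cell of the
dented datum IS (the anchored cover of) a `D″`-cell — the CONVERSE of ✓p750394 (`TorusCoverCubeRecordDentCells`: every `D″`-cell is a crown cell).  THIS FILE proves the converse
(§1: top, dent layer, the layers below and level `0`, the latter two under the displayed row «the label covers a site of `D₂.Om j′`» — at the record the collar «`π(□̃) ⊆ Ω_{j−1}`» +
nesting) and runs ✓`…RecCubeDomains` §2–§3 on it (§2 the (153) pairing for every `μ ∈ N(Q′_{D″})`, §3 the two `RE … = 0` rows).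

WHAT IS PROVED (kernel; `Params`, `N ≥ 1`; no definition).
§1 `lamSite_meet_of_lamSite_left_of_mem` (bookkeeping), ★★★ `lamSite_meet_top_of_mem_lamS_recordCubePZ` (`j′ = j`), ★★★ `lamSite_meet_dent_of_mem_lamS_recordCubePZ` (`j′ + 1 = j`,
   `1 ≤ j′`), ★★ `lamSite_meet_below_of_mem_lamS_recordCubePZ` (`1 ≤ j′`, `j′ + 1 < j`), ★★ `lamSite_meet_zero_of_mem_lamS_recordCubePZ` (level `0`, both `j = 1` and `j ≥ 2`).
§2 `support_row_domainsMeet_cubeDomains`, ★★★ `sum_laplace_mul_diverg_re∕im_eq_zero_of_isLandau138Z_recordCubePZ`.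
§3 ★★★ `RE_dsE_re_im_eq_zero_meet_of_isLandau138Z_recordCubePZ` — row 8 of `HThm4RecSym152PhiEG` at the dented datum.
HONEST FRAMING: count-neutral set bookkeeping + a by-name re-run of landed compositions; nothing of [15]∕[6]∕[II]∕[I] analysis asserted; the Landau form is a HYPOTHESIS (the crown's
clause); the rows «label covers a site of `D₂.Om j′`» below the top are DISPLAYED (discharged by the knit from the collar); `HThm4RecSym152PhiEG` ∕ `HThm4Rec*` UNDISCHARGED; N05 ∕ N07
NOT discharged; K0⁷ ∕ K1⁹ NOT closed; counts unmoved; one finite 𝕋⁴ programme at fixed ε — R4 closes the conditional finite-𝕋⁴ rung `BalabanLadder.UV` only; the YM mass gap (Clay) is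
NOT proved by any of this; nothing continuum ∕ ℝ⁴ ∕ OS.  No `def`, no `sorry`, no `instance`, no `notation`.

References: [15] (144) p. 300, (148)–(153) p. 301; [6] (1.29) p. 81, (1.38) p. 82, (1.131) p. 99; [II] (2.1)–(2.3) p. 224, (2.7) p. 224, (2.10)–(2.12) p. 225; [I] (0.1) p. 251, (0.3) p. 252.
-/

noncomputable section

namespace Literature.MathematicalPhysics.QuantumFieldTheory.Balaban1983to89.Node00

open scoped BigOperators Matrix.Norms.L2Operator InnerProductSpace RealInnerProductSpace
open Literature.MathematicalPhysics.QuantumLattice (blockMap blockSites)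
open B7Prop1Local (InBox)
open BlockAveragingZd (ctrShift)
open B7SectEFLinearisationRec (blockSitesZ)
open B8Eq138LandauZdRec (IsLandau138Z)
open B8Eq131Cubes (tLo tHi sqLo sqHi inLo inHi cube)
open B8Eq131CubesRec (cubeZ tcubeZ sqLoZ sqHiZ inLoZ inHiZ)
open B8Eq131CubesRecDictionary (inBox_sqZ_iff_add_ctrShift inBox_inZ_iff_add_ctrShift mem_cubeZ_iff_add_ctrShift)
open B8Eq131CubesAdmissible (smul_mem_cube_succ_iff)
open B8Eq119TwistedAxialRec (UnderZ flmZ underZ_flmZ underZ_iff_flmZ_eq)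
open B8BlockConstantLiftStabilityRec (underZ_add underZ_pow_smul)
open B8CubeMemberZd (cubeLam cubeLamS cubeLamS_top)
open B15Eq112TorusCover (cover)
open B14DomainGeom (Pt)
open B5Eq118OneStroke (iterBlockOf)
open B6SectADomainsV1 (Domains)
open LatticeFieldCalculus (laplace diverg)
open B6SectAOperatorsV1 (ScalarSpace RE dsE lapE QpE RE_eq_zero_iff mem_ker_QpE_iff lapE_apply dsE_apply inner_eq_sum)
open BalabanImbrieJaffe1984to88.BIJ85AxialPropagator411 (BondSpace)

variable {P : Params}

/-! ## §1  The converse dictionary: crown cells of the dented datum are cells of the meet -/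

section Cells

variable {Mc ρ j : ℕ} (hj : 1 ≤ j) (hjK : j ≤ P.m + P.K) (hρ : P.L ≤ ρ) (idx : Pt P.d) (D₂ : Domains P)

/-- A cell of the left family that lies in the right family's region is a cell of the meet. [cite: Balaban1984PropagatorsII, (2.3) p.224; Balaban1985Variational, (150) p.301 (bookkeeping)] -/
theorem lamSite_meet_of_lamSite_left_of_mem {D₁ : Domains P} {j' : ℕ} {y : Site P j'} (h₁ : D₁.LamSite j' y) (h₂ : y ∈ D₂.Om j') :
    (domainsMeet D₁ D₂).LamSite j' y := by
  refine ⟨(mem_domainsMeet_Om _ _ _ _).2 ⟨h₁.1, h₂⟩, fun hdeep => h₁.2 ?_⟩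
  have h := (mem_domainsMeet_Om D₁ D₂ (j' + 1) (blockOf y)).1 hdeep
  exact h.1

/-- ★★★ **TOP CELLS, CONVERSE**: a top (1.29)-cell `z ∈ (recordCubePZ … (D₂.Om j)).lamS j` of the dented datum covers a top cell of the meet: `π_j z ∈ Λ′_j(D″) = Ω′_j(□) ∩ D₂.Om j`
(its label lies in `□_j^{(j)}`; its centred tower lies in the lift of `D₂.Om j`, read at the centre `Lʲ·z`; nothing is deep at the top of the cube family).
[cite: Balaban1985Variational, (150) p.301; Balaban1985RegularSpaces, (1.29) p.81, (1.131) p.99; Balaban1984PropagatorsII, (2.3) p.224; Balaban1987RG1, (0.3) p.252] -/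
theorem lamSite_meet_top_of_mem_lamS_recordCubePZ {z : Pt P.d} (hz : z ∈ (recordCubePZ P j hj hjK Mc ρ hρ idx (D₂.Om j)).lamS j) :
    (domainsMeet (cubeDomains P (cornerP P Mc ρ idx) (sideP P Mc ρ) ρ j hjK) D₂).LamSite j (coverAt P j z) := by
  simp only [CubeB8DZ.lamS, recordCubePZ_k, le_refl, if_true, Set.mem_setOf_eq, lt_irrefl, IsEmpty.forall_iff, and_true, forall_true_left] at hz
  obtain ⟨hbox, htop⟩ := hz
  have hbox' : InBox (sqLo P.L (cornerP P Mc ρ idx) ρ j j) (sqHi P.L (cornerP P Mc ρ idx) (sideP P Mc ρ) ρ j j) z := by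
    rw [show (recordCubePZ P j hj hjK Mc ρ hρ idx (D₂.Om j)).a = cornerP P Mc ρ idx from rfl,
      show (recordCubePZ P j hj hjK Mc ρ hρ idx (D₂.Om j)).ρ = ρ from rfl,
      show (recordCubePZ P j hj hjK Mc ρ hρ idx (D₂.Om j)).M = sideP P Mc ρ from rfl,
      B8Eq131CubesRecDictionary.inBox_sqZ_top_iff] at hbox
    exact hbox
  have h₁ : coverAt P j z ∈ (cubeDomains P (cornerP P Mc ρ idx) (sideP P Mc ρ) ρ j hjK).Om j := coverAt_mem_cubeDomains_Om hj le_rfl hbox'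
  -- the tower condition read at the centre `Lʲ·z`
  have h₂ : coverAt P j z ∈ D₂.Om j := by
    have hx : UnderZ P.L j z (((P.L : ℤ) ^ j) • z) := underZ_pow_smul P.L j z
    have hmem := htop _ hx
    rw [dentFamZ_top] at hmem
    have hl := hmem.2
    rw [mem_liftTopZ_iff, iterBlockOf_cover hjK, blockMap_pow_add_ctrShift, (underZ_iff_flmZ_eq P.hL.1 j z _).1 hx] at hl
    exact hl
  refine ⟨(mem_domainsMeet_Om _ _ _ _).2 ⟨h₁, h₂⟩, fun hdeep => ?_⟩
  have h := ((mem_domainsMeet_Om _ D₂ (j + 1) _).1 hdeep).1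
  rw [cubeDomains_Om_of_lt (Nat.lt_succ_self j)] at h
  exact Finset.notMem_empty _ h

/-- ★★★ **DENT-LAYER CELLS, CONVERSE** (`j′ + 1 = j`, `1 ≤ j′`): a level-`j′` (1.29)-cell `z` of the DENTED datum whose anchored cover `y := π_{j′}(z + c_1·𝟙)` lies in `D₂.Om j′` (at the
record: `□_{j′} ⊆ □̃ ⊆ Ω_{j−1}`) is a cell of the meet: `y ∈ Ω′_{j′}(□)` by its label; and `y` is NOT deep in `D″` — if its parent block lay in `Ω′_j(□) ∩ D₂.Om j`, the label would be inner
(window injectivity, ✓`not_deep_cubeDomains_of_mem_cubeLam` read contrapositively) AND its tower would lie in `□̃ᶻ ∩ liftTopZ` (the parent block read through the lift at every fine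
site under `z`), which the crown's exclusion forbids. [cite: Balaban1985Variational, (148)–(150) p.301; Balaban1985RegularSpaces, (1.29) p.81, (1.131) p.99; Balaban1984PropagatorsII, (2.3) p.224; Balaban1987RG1, (0.1) p.251, (0.3) p.252] -/
theorem lamSite_meet_dent_of_mem_lamS_recordCubePZ (hinj : Set.InjOn (cover P) (cube P.L (cornerP P Mc ρ idx) (sideP P Mc ρ) ρ j 0))
    {j' : ℕ} (hj'1 : 1 ≤ j') (hj' : j' + 1 = j) {z : Pt P.d}
    (hz : z ∈ (recordCubePZ P j hj hjK Mc ρ hρ idx (D₂.Om j)).lamS j')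
    (hΩ : coverAt P j' (z + fun _ => ((ctrShift P.L (j - j') : ℕ) : ℤ)) ∈ D₂.Om j') :
    (domainsMeet (cubeDomains P (cornerP P Mc ρ idx) (sideP P Mc ρ) ρ j hjK) D₂).LamSite j' (coverAt P j' (z + fun _ => ((ctrShift P.L (j - j') : ℕ) : ℤ))) := by
  subst hj'
  have hj'j : j' < j' + 1 := Nat.lt_succ_self _
  have hj'le : j' ≤ j' + 1 := hj'j.le
  have hρ1 : 1 ≤ ρ := le_trans (le_trans (by norm_num) P.hL.2) hρ
  simp only [CubeB8DZ.lamS, recordCubePZ_k, hj'le, if_true, Set.mem_setOf_eq] at hz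
  obtain ⟨hbox, -, hexcl⟩ := hz
  set s : Pt P.d := z + fun _ => ((ctrShift P.L (j' + 1 - j') : ℕ) : ℤ) with hs
  -- the label box, centred ↔ corner
  have hbox' : InBox (sqLo P.L (cornerP P Mc ρ idx) ρ (j' + 1) j') (sqHi P.L (cornerP P Mc ρ idx) (sideP P Mc ρ) ρ (j' + 1) j') s := by
    rw [show (recordCubePZ P (j' + 1) hj hjK Mc ρ hρ idx (D₂.Om (j' + 1))).a = cornerP P Mc ρ idx from rfl,
      show (recordCubePZ P (j' + 1) hj hjK Mc ρ hρ idx (D₂.Om (j' + 1))).ρ = ρ from rfl,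
      show (recordCubePZ P (j' + 1) hj hjK Mc ρ hρ idx (D₂.Om (j' + 1))).M = sideP P Mc ρ from rfl,
      inBox_sqZ_iff_add_ctrShift] at hbox
    exact hbox
  have h₁ : (cubeDomains P (cornerP P Mc ρ idx) (sideP P Mc ρ) ρ (j' + 1) hjK).LamSite j' (coverAt P j' s) ∨
      (cubeDomains P (cornerP P Mc ρ idx) (sideP P Mc ρ) ρ (j' + 1) hjK).Deep j' (coverAt P j' s) := by
    by_cases hd : (cubeDomains P (cornerP P Mc ρ idx) (sideP P Mc ρ) ρ (j' + 1) hjK).Deep j' (coverAt P j' s)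
    · exact Or.inr hd
    · exact Or.inl ⟨coverAt_mem_cubeDomains_Om hj'1 hj'le hbox', hd⟩
  refine ⟨(mem_domainsMeet_Om _ _ _ _).2 ⟨coverAt_mem_cubeDomains_Om hj'1 hj'le hbox', hΩ⟩, fun hdeep => ?_⟩
  obtain ⟨hd₁, hd₂⟩ := (mem_domainsMeet_Om _ D₂ (j' + 1) _).1 hdeep
  -- (a) deep in the cube family ⇒ the label is inner (else it is a cube cell, not deep)
  have hinner : InBox (inLo P.L (cornerP P Mc ρ idx) ρ (j' + 1) j') (inHi P.L (cornerP P Mc ρ idx) (sideP P Mc ρ) ρ (j' + 1) j') s := by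
    by_contra hnot
    have hcell : s ∈ cubeLam P.L (cornerP P Mc ρ idx) (sideP P Mc ρ) ρ (j' + 1) j' := ⟨hbox', fun _ => hnot⟩
    exact not_deep_cubeDomains_of_mem_cubeLam hinj hj'le hcell hd₁
  -- (b) deep in `D₂` ⇒ the tower lies in `□̃ᶻ ∩ liftTopZ`
  have htower : ∀ x, UnderZ P.L j' z x → x ∈ dentFamZ P (j' + 1) Mc ρ idx (D₂.Om (j' + 1)) (j' + 1) := by
    intro x hx
    rw [dentFamZ_top]
    refine ⟨?_, ?_⟩
    · -- `x` under a label of `□_{j′}` lies in `□_{j′}ᶻ ⊆ □̃ᶻ`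
      exact B8Eq131CubesRec.cube_subset_tcube P.hL.1 P.hL.2 hρ1 hj'le ((B8Eq131CubesRec.mem_cube_iff P.hL.1).2 ⟨z, hbox, hx⟩)
    · rw [mem_liftTopZ_iff, iterBlockOf_cover_anchor_eq_blockOf hjK hx]
      exact hd₂
  -- the crown's exclusion at the dent layer
  have hin_c : InBox (inLoZ P.L (recordCubePZ P (j' + 1) hj hjK Mc ρ hρ idx (D₂.Om (j' + 1))).a (recordCubePZ P (j' + 1) hj hjK Mc ρ hρ idx (D₂.Om (j' + 1))).ρ (j' + 1) j')
      (inHiZ P.L (recordCubePZ P (j' + 1) hj hjK Mc ρ hρ idx (D₂.Om (j' + 1))).a (recordCubePZ P (j' + 1) hj hjK Mc ρ hρ idx (D₂.Om (j' + 1))).M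
        (recordCubePZ P (j' + 1) hj hjK Mc ρ hρ idx (D₂.Om (j' + 1))).ρ (j' + 1) j') z := by
    rw [show (recordCubePZ P (j' + 1) hj hjK Mc ρ hρ idx (D₂.Om (j' + 1))).a = cornerP P Mc ρ idx from rfl,
      show (recordCubePZ P (j' + 1) hj hjK Mc ρ hρ idx (D₂.Om (j' + 1))).ρ = ρ from rfl,
      show (recordCubePZ P (j' + 1) hj hjK Mc ρ hρ idx (D₂.Om (j' + 1))).M = sideP P Mc ρ from rfl,
      inBox_inZ_iff_add_ctrShift]
    exact hinner
  exact hexcl hj'j ⟨hin_c, fun _ => htower⟩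

/-- ★★ **THE LAYERS BELOW THE DENT, CONVERSE** (`1 ≤ j′`, `j′ + 1 < j`): a level-`j′` (1.29)-cell `z` of the dented datum whose anchored cover `y := π_{j′}(z + c_{j−j′}·𝟙)` lies in
`D₂.Om j′` is a cell of the meet — below the dent the crown's exclusion is «inner» alone, i.e. `z + c_{j−j′}·𝟙` is an engine cell `cubeLam … j′`, which covers a cell of the cube family
(✓`lamSite_cubeDomains_of_mem_cubeLam`). [cite: Balaban1985Variational, (144) p.300, (148) p.301; Balaban1985RegularSpaces, (1.29) p.81, (1.131) p.99; Balaban1984PropagatorsII, (2.3) p.224; Balaban1987RG1, (0.3) p.252] -/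
theorem lamSite_meet_below_of_mem_lamS_recordCubePZ (hinj : Set.InjOn (cover P) (cube P.L (cornerP P Mc ρ idx) (sideP P Mc ρ) ρ j 0))
    {j' : ℕ} (hj'1 : 1 ≤ j') (hj'j : j' + 1 < j) {z : Pt P.d}
    (hz : z ∈ (recordCubePZ P j hj hjK Mc ρ hρ idx (D₂.Om j)).lamS j')
    (hΩ : coverAt P j' (z + fun _ => ((ctrShift P.L (j - j') : ℕ) : ℤ)) ∈ D₂.Om j') :
    (domainsMeet (cubeDomains P (cornerP P Mc ρ idx) (sideP P Mc ρ) ρ j hjK) D₂).LamSite j' (coverAt P j' (z + fun _ => ((ctrShift P.L (j - j') : ℕ) : ℤ))) := by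
  have hj'le : j' ≤ j := by omega
  have hlt : j' < j := by omega
  simp only [CubeB8DZ.lamS, recordCubePZ_k, hj'le, if_true, Set.mem_setOf_eq] at hz
  obtain ⟨hbox, -, hexcl⟩ := hz
  set s : Pt P.d := z + fun _ => ((ctrShift P.L (j - j') : ℕ) : ℤ) with hs
  have hbox' : InBox (sqLo P.L (cornerP P Mc ρ idx) ρ j j') (sqHi P.L (cornerP P Mc ρ idx) (sideP P Mc ρ) ρ j j') s := by
    rw [show (recordCubePZ P j hj hjK Mc ρ hρ idx (D₂.Om j)).a = cornerP P Mc ρ idx from rfl,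
      show (recordCubePZ P j hj hjK Mc ρ hρ idx (D₂.Om j)).ρ = ρ from rfl,
      show (recordCubePZ P j hj hjK Mc ρ hρ idx (D₂.Om j)).M = sideP P Mc ρ from rfl,
      inBox_sqZ_iff_add_ctrShift] at hbox
    exact hbox
  have hnin : ¬ InBox (inLo P.L (cornerP P Mc ρ idx) ρ j j') (inHi P.L (cornerP P Mc ρ idx) (sideP P Mc ρ) ρ j j') s := by
    intro hin
    refine hexcl hlt ⟨?_, fun h => absurd h (by omega)⟩
    rw [show (recordCubePZ P j hj hjK Mc ρ hρ idx (D₂.Om j)).a = cornerP P Mc ρ idx from rfl,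
      show (recordCubePZ P j hj hjK Mc ρ hρ idx (D₂.Om j)).ρ = ρ from rfl,
      show (recordCubePZ P j hj hjK Mc ρ hρ idx (D₂.Om j)).M = sideP P Mc ρ from rfl,
      inBox_inZ_iff_add_ctrShift]
    exact hin
  have hcell : s ∈ cubeLam P.L (cornerP P Mc ρ idx) (sideP P Mc ρ) ρ j j' := ⟨hbox', fun _ => hnin⟩
  exact lamSite_meet_of_lamSite_left_of_mem D₂ (lamSite_cubeDomains_of_mem_cubeLam hinj hj'1 hj'le hcell) hΩ

/-- ★★ **LEVEL `0` INSIDE `□₀ᶻ`, CONVERSE**: a level-`0` (1.29)-cell `x` of the dented datum covers, after the anchor `c_j·𝟙`, a level-`0` cell of the meet: for `j ≥ 2` the exclusion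
is «`x + c_j ∉ □₁`» and ✓`lamSite_zero_cubeDomains` applies; for `j = 1` (the dent layer IS level `0`) the parent block cannot lie in `Ω′₁(□) ∩ D₂.Om 1` by the crown's dent-layer
exclusion (inner + lift), exactly as on the dent layer. [cite: Balaban1985Variational, (148)–(150) p.301; Balaban1985RegularSpaces, (1.29) p.81, (1.131) p.99; Balaban1984PropagatorsII, (2.3) p.224; Balaban1987RG1, (0.3) p.252] -/
theorem lamSite_meet_zero_of_mem_lamS_recordCubePZ (hinj : Set.InjOn (cover P) (cube P.L (cornerP P Mc ρ idx) (sideP P Mc ρ) ρ j 0))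
    {x : Pt P.d} (hx : x ∈ (recordCubePZ P j hj hjK Mc ρ hρ idx (D₂.Om j)).lamS 0) :
    (domainsMeet (cubeDomains P (cornerP P Mc ρ idx) (sideP P Mc ρ) ρ j hjK) D₂).LamSite 0 (cover P (x + fun _ => ((ctrShift P.L j : ℕ) : ℤ))) := by
  have hρ1 : 1 ≤ ρ := le_trans (le_trans (by norm_num) P.hL.2) hρ
  simp only [CubeB8DZ.lamS, recordCubePZ_k, Nat.zero_le, if_true, Set.mem_setOf_eq] at hx
  obtain ⟨hbox, -, hexcl⟩ := hx
  set s : Pt P.d := x + fun _ => ((ctrShift P.L j : ℕ) : ℤ) with hs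
  have hlt : 0 < j := hj
  -- the label box at level `0`: `x + c_j ∈ □₀` (engine)
  have hbox' : s ∈ cube P.L (cornerP P Mc ρ idx) (sideP P Mc ρ) ρ j 0 := by
    have h : x ∈ cubeZ P.L (cornerP P Mc ρ idx) (sideP P Mc ρ) ρ j 0 := by
      rw [show (recordCubePZ P j hj hjK Mc ρ hρ idx (D₂.Om j)).a = cornerP P Mc ρ idx from rfl,
        show (recordCubePZ P j hj hjK Mc ρ hρ idx (D₂.Om j)).ρ = ρ from rfl,
        show (recordCubePZ P j hj hjK Mc ρ hρ idx (D₂.Om j)).M = sideP P Mc ρ from rfl] at hbox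
      exact (B8Eq131CubesRec.mem_cube_iff P.hL.1).2 ⟨x, hbox, (B8Eq119TwistedAxialRec.underZ_zero_iff P.L x x).2 rfl⟩
    exact (mem_cubeZ_iff_add_ctrShift P.hL.1 _ _ _ (Nat.zero_le j) x).1 h
  rw [B6SectADomainsV1.Domains.lamSite_zero_iff]
  intro hdeep
  obtain ⟨hd₁, hd₂⟩ := (mem_domainsMeet_Om _ D₂ (0 + 1) _).1 hdeep
  rcases Nat.lt_or_ge j 2 with hj1 | hj2
  · -- `j = 1`: the dent layer is level `0`
    have hj1' : j = 1 := by omega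
    subst hj1'
    -- deep in the cube family ⇒ inner
    have hinner : InBox (inLo P.L (cornerP P Mc ρ idx) ρ 1 0) (inHi P.L (cornerP P Mc ρ idx) (sideP P Mc ρ) ρ 1 0) s := by
      by_contra hnot
      have hs1 : s ∉ cube P.L (cornerP P Mc ρ idx) (sideP P Mc ρ) ρ 1 1 := by
        intro h1
        apply hnot
        have := (smul_mem_cube_succ_iff P.L_pos (cornerP P Mc ρ idx) (sideP P Mc ρ) ρ (k := 1) (j := 0) (by norm_num) s).1
        rw [pow_zero, one_smul] at this
        exact this h1
      exact (B6SectADomainsV1.Domains.lamSite_zero_iff _ _).1 (lamSite_zero_cubeDomains hinj le_rfl hbox' hs1) hd₁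
    have htower : ∀ w, UnderZ P.L 0 x w → w ∈ dentFamZ P 1 Mc ρ idx (D₂.Om 1) 1 := by
      intro w hw
      have hwx : w = x := (B8Eq119TwistedAxialRec.underZ_zero_iff P.L x w).1 hw
      subst hwx
      rw [dentFamZ_top]
      refine ⟨?_, ?_⟩
      · exact B8Eq131CubesRec.cube_subset_tcube P.hL.1 P.hL.2 hρ1 (Nat.zero_le 1)
          ((B8Eq131CubesRec.mem_cube_iff P.hL.1).2 ⟨w, hbox, hw⟩)
      · rw [mem_liftTopZ_iff, iterBlockOf_cover_anchor_eq_blockOf (j' := 0) hjK hw]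
        have h0 : (w + fun _ => ((ctrShift P.L (0 + 1 - 0) : ℕ) : ℤ)) = s := by rw [hs]
        rw [h0, coverAt_zero]
        exact hd₂
    have hin_c : InBox (inLoZ P.L (recordCubePZ P 1 hj hjK Mc ρ hρ idx (D₂.Om 1)).a (recordCubePZ P 1 hj hjK Mc ρ hρ idx (D₂.Om 1)).ρ 1 0)
        (inHiZ P.L (recordCubePZ P 1 hj hjK Mc ρ hρ idx (D₂.Om 1)).a (recordCubePZ P 1 hj hjK Mc ρ hρ idx (D₂.Om 1)).M
          (recordCubePZ P 1 hj hjK Mc ρ hρ idx (D₂.Om 1)).ρ 1 0) x := by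
      rw [show (recordCubePZ P 1 hj hjK Mc ρ hρ idx (D₂.Om 1)).a = cornerP P Mc ρ idx from rfl,
        show (recordCubePZ P 1 hj hjK Mc ρ hρ idx (D₂.Om 1)).ρ = ρ from rfl,
        show (recordCubePZ P 1 hj hjK Mc ρ hρ idx (D₂.Om 1)).M = sideP P Mc ρ from rfl,
        inBox_inZ_iff_add_ctrShift, Nat.sub_zero]
      exact hinner
    exact hexcl (by norm_num) ⟨hin_c, fun _ => htower⟩
  · -- `j ≥ 2`: the exclusion is «not inner», i.e. `x + c_j ∉ □₁`
    have hs1 : s ∉ cube P.L (cornerP P Mc ρ idx) (sideP P Mc ρ) ρ j 1 := by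
      intro h1
      refine hexcl hlt ⟨?_, fun h => absurd h (by omega)⟩
      rw [show (recordCubePZ P j hj hjK Mc ρ hρ idx (D₂.Om j)).a = cornerP P Mc ρ idx from rfl,
        show (recordCubePZ P j hj hjK Mc ρ hρ idx (D₂.Om j)).ρ = ρ from rfl,
        show (recordCubePZ P j hj hjK Mc ρ hρ idx (D₂.Om j)).M = sideP P Mc ρ from rfl,
        inBox_inZ_iff_add_ctrShift, Nat.sub_zero]
      have := (smul_mem_cube_succ_iff P.L_pos (cornerP P Mc ρ idx) (sideP P Mc ρ) ρ (k := j) (j := 0) (by omega) s).1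
      rw [pow_zero, one_smul] at this
      exact this h1
    exact (B6SectADomainsV1.Domains.lamSite_zero_iff _ _).1 (lamSite_zero_cubeDomains hinj hj hbox' hs1) hd₁

end Cells

/-! ## §2  The (153) pairing on the torus for every `μ ∈ N(Q′_{D″})`, dented datum -/

section Pairing

variable {Mc ρ j : ℕ} (hj : 1 ≤ j) (hjK : j ≤ P.m + P.K) (hρ : P.L ≤ ρ) (idx : Pt P.d) (D₂ : Domains P)

/-- ★ **THE SUPPORT ROW FOR THE MEET**: every `μ ∈ N(Q′)` of `D″ = cubeDomains ⊓ D₂` is supported on `π(□₁)` (a site off the cube family's `Ω₁` is a level-`0` cell of the meet, where `μ = 0`).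
[cite: Balaban1984PropagatorsII, (2.7) p.224, (2.10) p.225; Balaban1985Variational, (150) p.301] -/
theorem support_row_domainsMeet_cubeDomains (hj : 1 ≤ j) {μ : SiteField P 0 ℝ} (hμ : (domainsMeet (cubeDomains P (cornerP P Mc ρ idx) (sideP P Mc ρ) ρ j hjK) D₂).InGauge μ) :
    ∀ y, μ y ≠ 0 → y ∈ cover P '' cube P.L (cornerP P Mc ρ idx) (sideP P Mc ρ) ρ j 1 :=
  support_row_of_inGauge _ hμ fun y hy => by
    have hd₁ : (cubeDomains P (cornerP P Mc ρ idx) (sideP P Mc ρ) ρ j hjK).Deep 0 y := ((mem_domainsMeet_Om _ D₂ (0 + 1) _).1 hy).1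
    obtain ⟨s, hs, hsy⟩ := exists_label_cube_one_of_deep_zero (hk := hjK) hj hd₁
    exact ⟨s, hs, hsy⟩

variable {𝔸 : Type*} [NormedRing 𝔸] [NormedAlgebra ℂ 𝔸] [CompleteSpace 𝔸]

/-- ★★★ **[15] (153) ∕ [II] (2.12) AT THE RECORD's TORUS FROM THE LANDAU FORM ON THE DENTED CELLS, FOR EVERY `μ ∈ N(Q′_{D″})`, REAL PART.**  Data: the dented datum
`c := recordCubePZ P j hj hjK Mc ρ hρ idx (D₂.Om j)` whose engine `□₀` does not wrap; a torus potential `A` with `A ⟨π(x + c_j·𝟙), κ⟩ = A″ x κ` on `□₀ᶻ = c.sq 0` and `IsLandau138Z L j η (c.sq 0)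
c.lamS 1 A″`; the displayed row «below the top, the anchored cover of every crown cell lies in `D₂.Om j′`» (at the record: the collar `π(□̃) ⊆ Ω_{j−1}` + nesting).  Then for every `μ` with
`(domainsMeet (cubeDomains …) D₂).InGauge μ` and every `φ`: `Σ_y (laplace η⁻¹ μ)(y)·(diverg η⁻¹ (Re(φ∘A)))(y) = 0` — g9's FILE 44 engine with the rows read at the MEET's cells through §1.
[cite: Balaban1985Variational, (150)–(153) p.301; Balaban1985RegularSpaces, (1.38) p.82, (1.131) p.99; Balaban1984PropagatorsII, (2.7) p.224, (2.10)–(2.12) p.225; Balaban1987RG1, (0.3) p.252] -/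
theorem sum_laplace_mul_diverg_re_eq_zero_of_isLandau138Z_recordCubePZ
    (hinj : Set.InjOn (cover P) (cube P.L (cornerP P Mc ρ idx) (sideP P Mc ρ) ρ j 0)) {η : ℝ}
    {A'' : Pt P.d → Fin P.d → 𝔸} {A : PBond P 0 → 𝔸}
    (hA : ∀ x, x ∈ (recordCubePZ P j hj hjK Mc ρ hρ idx (D₂.Om j)).sq 0 → ∀ κ, A ⟨cover P (x + fun _ => (ctrShift P.L j : ℤ)), κ⟩ = A'' x κ)
    (hLan : IsLandau138Z P.L j η ((recordCubePZ P j hj hjK Mc ρ hρ idx (D₂.Om j)).sq 0) (recordCubePZ P j hj hjK Mc ρ hρ idx (D₂.Om j)).lamS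
      (1 : B7Prop1Explicit.Site P.d → Fin P.d → 𝔸ˣ) A'')
    (hΩ : ∀ j', 1 ≤ j' → j' < j → ∀ z ∈ (recordCubePZ P j hj hjK Mc ρ hρ idx (D₂.Om j)).lamS j',
      coverAt P j' (z + fun _ => ((ctrShift P.L (j - j') : ℕ) : ℤ)) ∈ D₂.Om j')
    {μ : SiteField P 0 ℝ} (hμ : (domainsMeet (cubeDomains P (cornerP P Mc ρ idx) (sideP P Mc ρ) ρ j hjK) D₂).InGauge μ) (φ : 𝔸 →L[ℂ] ℂ) :
    ∑ y : Site P 0, laplace η⁻¹ μ y * diverg η⁻¹ (fun b => (φ (A b)).re) y = 0 := by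
  have hLo : Odd P.L := P.hL.1
  set c := recordCubePZ P j hj hjK Mc ρ hρ idx (D₂.Om j) with hc
  set D'' := domainsMeet (cubeDomains P (cornerP P Mc ρ idx) (sideP P Mc ρ) ρ j hjK) D₂ with hD''
  set X : Set (Pt P.d) := cube P.L (cornerP P Mc ρ idx) (sideP P Mc ρ) ρ j 0 with hX
  -- the record `□₀ᶻ` and the engine `□₀`
  have hsq0 : c.sq 0 = cubeZ P.L (cornerP P Mc ρ idx) (sideP P Mc ρ) ρ j 0 := c.sq_zero
  have h0X : ∀ x : Pt P.d, x ∈ c.sq 0 ↔ (x + fun _ => (ctrShift P.L j : ℤ)) ∈ X := fun x => by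
    rw [hsq0]; exact mem_cubeZ_iff_add_ctrShift hLo _ _ _ (Nat.zero_le j) x
  have hXΩ : X ⊆ (fun y => y + fun _ => ((ctrShift P.L j : ℕ) : ℤ)) '' c.sq 0 := fun y hy =>
    ⟨y - fun _ => (ctrShift P.L j : ℤ), (h0X _).2 (by rwa [sub_add_cancel]), sub_add_cancel y _⟩
  have hfin : (c.sq 0).Finite := by
    have hXfin : X.Finite := by
      rw [hX, ← B8Eq131CubesAdmissible.cubeFam_false_zero]
      exact B8Eq191FlatLettersCubeMember.cubeFam_zero_finite P.L _ _ _ _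
    refine (hXfin.preimage (Set.injOn_of_injective (add_left_injective (fun _ => (ctrShift P.L j : ℤ))))).subset fun x hx => ?_
    exact (h0X x).1 hx
  have hA' : ∀ z, z ∈ X → ∀ κ, A ⟨cover P z, κ⟩ = A'' (z - fun _ => ((ctrShift P.L j : ℕ) : ℤ)) κ := by
    intro z hz κ
    have h := hA (z - fun _ => (ctrShift P.L j : ℤ)) ((h0X _).2 (by rwa [sub_add_cancel])) κ
    rwa [sub_add_cancel] at h
  -- the engine cube `CubeB8.ofUniv` of the same numbers, for N05's collar lemma `□₁ + 2 ⊆ □₀`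
  set c' : CubeB8 P.d P.L j (fun _ => (Set.univ : Set (B7Prop1Explicit.Site P.d))) :=
    CubeB8.ofUniv j (cornerP P Mc ρ idx) (sideP P Mc ρ) ρ hj le_rfl hρ c.ρ_le_M c.big c.L_le_dM rfl rfl with hc'
  have hc'0 : c'.sq 0 = X := B8Eq131CubesAdmissible.cubeFam_false_zero P.L _ _ _ _
  have hS : ∀ s ∈ cube P.L (cornerP P Mc ρ idx) (sideP P Mc ρ) ρ j 1, ∀ z : Pt P.d, (∀ i, |z i - s i| ≤ 2) → z ∈ X := fun s hs z hz => by
    rw [← hc'0]; exact mem_sq_zero_of_near_sq_one c' hs hz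
  refine sum_laplace_mul_diverg_re_eq_zero_of_isLandau138Z_cover hLo hfin hLan _ hXΩ hinj hA'
    (support_row_domainsMeet_cubeDomains (hjK := hjK) (idx := idx) (D₂ := D₂) hj hμ) hS (fun x hx => ?_) (fun j' hj' hj'k y hy => ?_) φ
  · -- row (h0): a level-0 crown cell covers a level-0 cell of the meet, where `μ` vanishes
    by_cases hxX : (x + fun _ => ((ctrShift P.L j : ℕ) : ℤ)) ∈ X
    · rw [Set.indicator_of_mem hxX, apply_cover_eq_zero_of_inGauge D'' hμ (lamSite_meet_zero_of_mem_lamS_recordCubePZ hj hjK hρ idx D₂ hinj hx),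
        Complex.ofReal_zero]
    · rw [Set.indicator_of_notMem hxX]
  · -- row (hQ): a level-`j′` crown cell covers (after the anchor) a level-`j′` cell of the meet, where `μ`'s block sum vanishes
    rw [sum_blockSitesZ_add_ctrShift hj'k y]
    -- the engine label box of the cell, for the window inclusion
    have hbox : InBox (sqLoZ P.L (cornerP P Mc ρ idx) ρ j j') (sqHiZ P.L (cornerP P Mc ρ idx) (sideP P Mc ρ) ρ j j') y := by
      have h := hy
      simp only [hc, CubeB8DZ.lamS, recordCubePZ_k, hj'k, if_true, Set.mem_setOf_eq] at h
      exact h.1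
    have hbox' : InBox (sqLo P.L (cornerP P Mc ρ idx) ρ j j') (sqHi P.L (cornerP P Mc ρ idx) (sideP P Mc ρ) ρ j j') (y + fun _ => ((ctrShift P.L (j - j') : ℕ) : ℤ)) :=
      (inBox_sqZ_iff_add_ctrShift P.L _ _ _ _ _ y).1 hbox
    have hwin : (↑(blockSites (P.L ^ j') (y + fun _ => ((ctrShift P.L (j - j') : ℕ) : ℤ))) : Set (Pt P.d)) ⊆ X :=
      (blockSites_subset_cube_of_inBox hbox').trans (B8Eq131Cubes.cube_anti (Nat.zero_le _) hj'k)
    -- the meet cell, by §1's case split on the level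
    have hcell : D''.LamSite j' (coverAt P j' (y + fun _ => ((ctrShift P.L (j - j') : ℕ) : ℤ))) := by
      rcases Nat.lt_or_ge j' j with hlt | hge
      · rcases Nat.lt_or_ge (j' + 1) j with hlt2 | hge2
        · exact lamSite_meet_below_of_mem_lamS_recordCubePZ hj hjK hρ idx D₂ hinj hj' hlt2 hy (hΩ j' hj' hlt y hy)
        · have hj'1 : j' + 1 = j := by omega
          exact lamSite_meet_dent_of_mem_lamS_recordCubePZ hj hjK hρ idx D₂ hinj hj' hj'1 hy (hΩ j' hj' hlt y hy)
      · have hjj : j' = j := le_antisymm hj'k hge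
        subst hjj
        have h0 : (y + fun _ => ((ctrShift P.L (j' - j') : ℕ) : ℤ)) = y := by
          funext i; simp [BlockAveragingZd.ctrShift]
        rw [h0]
        exact lamSite_meet_top_of_mem_lamS_recordCubePZ hj hjK hρ idx D₂ hy
    exact sum_blockSites_indicator_cover_eq_zero_of_inGauge D'' hμ hcell hwin

/-- ★★★ **The same, IMAGINARY PART** (`a := Im(φ ∘ A)`). [cite: Balaban1985Variational, (153) p.301; Balaban1984PropagatorsII, (2.7) p.224, (2.12) p.225; Balaban1987RG1, (0.3) p.252] -/
theorem sum_laplace_mul_diverg_im_eq_zero_of_isLandau138Z_recordCubePZ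
    (hinj : Set.InjOn (cover P) (cube P.L (cornerP P Mc ρ idx) (sideP P Mc ρ) ρ j 0)) {η : ℝ}
    {A'' : Pt P.d → Fin P.d → 𝔸} {A : PBond P 0 → 𝔸}
    (hA : ∀ x, x ∈ (recordCubePZ P j hj hjK Mc ρ hρ idx (D₂.Om j)).sq 0 → ∀ κ, A ⟨cover P (x + fun _ => (ctrShift P.L j : ℤ)), κ⟩ = A'' x κ)
    (hLan : IsLandau138Z P.L j η ((recordCubePZ P j hj hjK Mc ρ hρ idx (D₂.Om j)).sq 0) (recordCubePZ P j hj hjK Mc ρ hρ idx (D₂.Om j)).lamS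
      (1 : B7Prop1Explicit.Site P.d → Fin P.d → 𝔸ˣ) A'')
    (hΩ : ∀ j', 1 ≤ j' → j' < j → ∀ z ∈ (recordCubePZ P j hj hjK Mc ρ hρ idx (D₂.Om j)).lamS j',
      coverAt P j' (z + fun _ => ((ctrShift P.L (j - j') : ℕ) : ℤ)) ∈ D₂.Om j')
    {μ : SiteField P 0 ℝ} (hμ : (domainsMeet (cubeDomains P (cornerP P Mc ρ idx) (sideP P Mc ρ) ρ j hjK) D₂).InGauge μ) (φ : 𝔸 →L[ℂ] ℂ) :
    ∑ y : Site P 0, laplace η⁻¹ μ y * diverg η⁻¹ (fun b => (φ (A b)).im) y = 0 := by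
  have hLo : Odd P.L := P.hL.1
  set c := recordCubePZ P j hj hjK Mc ρ hρ idx (D₂.Om j) with hc
  set D'' := domainsMeet (cubeDomains P (cornerP P Mc ρ idx) (sideP P Mc ρ) ρ j hjK) D₂ with hD''
  set X : Set (Pt P.d) := cube P.L (cornerP P Mc ρ idx) (sideP P Mc ρ) ρ j 0 with hX
  have hsq0 : c.sq 0 = cubeZ P.L (cornerP P Mc ρ idx) (sideP P Mc ρ) ρ j 0 := c.sq_zero
  have h0X : ∀ x : Pt P.d, x ∈ c.sq 0 ↔ (x + fun _ => (ctrShift P.L j : ℤ)) ∈ X := fun x => by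
    rw [hsq0]; exact mem_cubeZ_iff_add_ctrShift hLo _ _ _ (Nat.zero_le j) x
  have hXΩ : X ⊆ (fun y => y + fun _ => ((ctrShift P.L j : ℕ) : ℤ)) '' c.sq 0 := fun y hy =>
    ⟨y - fun _ => (ctrShift P.L j : ℤ), (h0X _).2 (by rwa [sub_add_cancel]), sub_add_cancel y _⟩
  have hfin : (c.sq 0).Finite := by
    have hXfin : X.Finite := by
      rw [hX, ← B8Eq131CubesAdmissible.cubeFam_false_zero]
      exact B8Eq191FlatLettersCubeMember.cubeFam_zero_finite P.L _ _ _ _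
    refine (hXfin.preimage (Set.injOn_of_injective (add_left_injective (fun _ => (ctrShift P.L j : ℤ))))).subset fun x hx => ?_
    exact (h0X x).1 hx
  have hA' : ∀ z, z ∈ X → ∀ κ, A ⟨cover P z, κ⟩ = A'' (z - fun _ => ((ctrShift P.L j : ℕ) : ℤ)) κ := by
    intro z hz κ
    have h := hA (z - fun _ => (ctrShift P.L j : ℤ)) ((h0X _).2 (by rwa [sub_add_cancel])) κ
    rwa [sub_add_cancel] at h
  set c' : CubeB8 P.d P.L j (fun _ => (Set.univ : Set (B7Prop1Explicit.Site P.d))) :=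
    CubeB8.ofUniv j (cornerP P Mc ρ idx) (sideP P Mc ρ) ρ hj le_rfl hρ c.ρ_le_M c.big c.L_le_dM rfl rfl with hc'
  have hc'0 : c'.sq 0 = X := B8Eq131CubesAdmissible.cubeFam_false_zero P.L _ _ _ _
  have hS : ∀ s ∈ cube P.L (cornerP P Mc ρ idx) (sideP P Mc ρ) ρ j 1, ∀ z : Pt P.d, (∀ i, |z i - s i| ≤ 2) → z ∈ X := fun s hs z hz => by
    rw [← hc'0]; exact mem_sq_zero_of_near_sq_one c' hs hz
  refine sum_laplace_mul_diverg_im_eq_zero_of_isLandau138Z_cover hLo hfin hLan _ hXΩ hinj hA'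
    (support_row_domainsMeet_cubeDomains (hjK := hjK) (idx := idx) (D₂ := D₂) hj hμ) hS (fun x hx => ?_) (fun j' hj' hj'k y hy => ?_) φ
  · by_cases hxX : (x + fun _ => ((ctrShift P.L j : ℕ) : ℤ)) ∈ X
    · rw [Set.indicator_of_mem hxX, apply_cover_eq_zero_of_inGauge D'' hμ (lamSite_meet_zero_of_mem_lamS_recordCubePZ hj hjK hρ idx D₂ hinj hx),
        Complex.ofReal_zero]
    · rw [Set.indicator_of_notMem hxX]
  · rw [sum_blockSitesZ_add_ctrShift hj'k y]
    have hbox : InBox (sqLoZ P.L (cornerP P Mc ρ idx) ρ j j') (sqHiZ P.L (cornerP P Mc ρ idx) (sideP P Mc ρ) ρ j j') y := by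
      have h := hy
      simp only [hc, CubeB8DZ.lamS, recordCubePZ_k, hj'k, if_true, Set.mem_setOf_eq] at h
      exact h.1
    have hbox' : InBox (sqLo P.L (cornerP P Mc ρ idx) ρ j j') (sqHi P.L (cornerP P Mc ρ idx) (sideP P Mc ρ) ρ j j') (y + fun _ => ((ctrShift P.L (j - j') : ℕ) : ℤ)) :=
      (inBox_sqZ_iff_add_ctrShift P.L _ _ _ _ _ y).1 hbox
    have hwin : (↑(blockSites (P.L ^ j') (y + fun _ => ((ctrShift P.L (j - j') : ℕ) : ℤ))) : Set (Pt P.d)) ⊆ X :=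
      (blockSites_subset_cube_of_inBox hbox').trans (B8Eq131Cubes.cube_anti (Nat.zero_le _) hj'k)
    have hcell : D''.LamSite j' (coverAt P j' (y + fun _ => ((ctrShift P.L (j - j') : ℕ) : ℤ))) := by
      rcases Nat.lt_or_ge j' j with hlt | hge
      · rcases Nat.lt_or_ge (j' + 1) j with hlt2 | hge2
        · exact lamSite_meet_below_of_mem_lamS_recordCubePZ hj hjK hρ idx D₂ hinj hj' hlt2 hy (hΩ j' hj' hlt y hy)
        · have hj'1 : j' + 1 = j := by omega
          exact lamSite_meet_dent_of_mem_lamS_recordCubePZ hj hjK hρ idx D₂ hinj hj' hj'1 hy (hΩ j' hj' hlt y hy)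
      · have hjj : j' = j := le_antisymm hj'k hge
        subst hjj
        have h0 : (y + fun _ => ((ctrShift P.L (j' - j') : ℕ) : ℤ)) = y := by
          funext i; simp [BlockAveragingZd.ctrShift]
        rw [h0]
        exact lamSite_meet_top_of_mem_lamS_recordCubePZ hj hjK hρ idx D₂ hy
    exact sum_blockSites_indicator_cover_eq_zero_of_inGauge D'' hμ hcell hwin

end Pairing

/-! ## §3  ★★★ Row 8 of the def of record at the dented datum: `RE (domainsMeet (cubeDomains …) D₂) η⁻¹ (dsE η⁻¹ (Re∕Im(φ∘A))) = 0` -/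

section Last

variable {N : ℕ} {Mc ρ j : ℕ} (hj : 1 ≤ j) (hjK : j ≤ P.m + P.K) (hρ : P.L ≤ ρ) (idx : Pt P.d) (D₂ : Domains P)

/-- ★★★ **[15] (153) IN p21's LETTERS AT THE MEET, DENTED DATUM** — `HThm4RecSym152PhiEG`'s row 8 at `D₂ := domainsOfSeq s.Ω j hk`: under the data of §2 (with `𝔸 = M_N(ℂ)`), both
`RE (domainsMeet (cubeDomains …) D₂) η⁻¹ (dsE η⁻¹ (Re(φ∘A))) = 0` and `… (Im(φ∘A)) … = 0` ([II] (2.12): `R ∂*a = 0 ⟺ ⟨Δμ, ∂*a⟩ = 0` for every `μ ∈ N(Q′)`). The `recordCubePZ` twin of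
✓`RE_dsE_re_im_eq_zero_meet_of_isLandau138Z_propCubePZ`, with NO kernel inclusion: the rows are read at the meet's own cells.
[cite: Balaban1985Variational, (150)–(153) p.301; Balaban1985RegularSpaces, (1.38) p.82; Balaban1984PropagatorsII, (2.7) p.224, (2.10)–(2.12) p.225; Balaban1987RG1, (0.3) p.252] -/
theorem RE_dsE_re_im_eq_zero_meet_of_isLandau138Z_recordCubePZ
    (hinj : Set.InjOn (cover P) (cube P.L (cornerP P Mc ρ idx) (sideP P Mc ρ) ρ j 0)) {η : ℝ}
    {A'' : Pt P.d → Fin P.d → MatA N} {A : PBond P 0 → MatA N}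
    (hA : ∀ x, x ∈ (recordCubePZ P j hj hjK Mc ρ hρ idx (D₂.Om j)).sq 0 → ∀ κ, A ⟨cover P (x + fun _ => (ctrShift P.L j : ℤ)), κ⟩ = A'' x κ)
    (hLan : IsLandau138Z P.L j η ((recordCubePZ P j hj hjK Mc ρ hρ idx (D₂.Om j)).sq 0) (recordCubePZ P j hj hjK Mc ρ hρ idx (D₂.Om j)).lamS
      (1 : B7Prop1Explicit.Site P.d → Fin P.d → (MatA N)ˣ) A'')
    (hΩ : ∀ j', 1 ≤ j' → j' < j → ∀ z ∈ (recordCubePZ P j hj hjK Mc ρ hρ idx (D₂.Om j)).lamS j',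
      coverAt P j' (z + fun _ => ((ctrShift P.L (j - j') : ℕ) : ℤ)) ∈ D₂.Om j')
    (φ : MatA N →L[ℂ] ℂ) :
    RE (domainsMeet (cubeDomains P (cornerP P Mc ρ idx) (sideP P Mc ρ) ρ j hjK) D₂) η⁻¹ (dsE η⁻¹ (WithLp.toLp 2 fun b => (φ (A b)).re : BondSpace P)) = 0 ∧
      RE (domainsMeet (cubeDomains P (cornerP P Mc ρ idx) (sideP P Mc ρ) ρ j hjK) D₂) η⁻¹ (dsE η⁻¹ (WithLp.toLp 2 fun b => (φ (A b)).im : BondSpace P)) = 0 := by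
  constructor
  · rw [RE_eq_zero_iff]
    intro v hv
    rw [mem_ker_QpE_iff] at hv
    rw [inner_eq_sum]
    simp_rw [lapE_apply, dsE_apply]
    exact sum_laplace_mul_diverg_re_eq_zero_of_isLandau138Z_recordCubePZ hj hjK hρ idx D₂ hinj hA hLan hΩ hv φ
  · rw [RE_eq_zero_iff]
    intro v hv
    rw [mem_ker_QpE_iff] at hv
    rw [inner_eq_sum]
    simp_rw [lapE_apply, dsE_apply]
    exact sum_laplace_mul_diverg_im_eq_zero_of_isLandau138Z_recordCubePZ hj hjK hρ idx D₂ hinj hA hLan hΩ hv φ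

end Last


end Literature.MathematicalPhysics.QuantumFieldTheory.Balaban1983to89.Node00

end
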